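import Mathlib
import HarnessLib

/-!
# Diagonalisability of the summands of a diagonalisable Kronecker sum `A ⊗ 1 + 1 ⊗ B`

Topic `LinearAlgebra/Matrix`; theorems only (no definition, no named fact). Everything is over an
algebraically closed field `K` (the application is `K = ℂ`) and "diagonalisable" is spelled
concretely: `∃ S d, IsUnit S.det ∧ A * S = S * diagonal d` (the columns of `S` form an
eigenbasis).

* `exists_mul_eq_mul_diagonal_of_span_eigenvectors` — if the eigenvectors of a square matrix `A`
  span `K^n`, then `A` is diagonalisable (extract a basis from the spanning family).
* `kroneckerSum_mulVec_apply` — the Kronecker sum `A ⊗ 1 + 1 ⊗ B` acts on a vector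
  `v ∈ K^{n × n}`, read as the matrix `V_{im} = v(i,m)`, by `V ↦ A V + V Bᵀ`.
* `exists_mul_eq_mul_diagonal_left_of_kroneckerSum`,
  `exists_mul_eq_mul_diagonal_right_of_kroneckerSum` — **if `A ⊗ 1 + 1 ⊗ B` is diagonalisable
  (`n ≠ ∅`), then so are `A` and `B`.** Proof for `A`: if `(A ⊗ 1 + 1 ⊗ B) S = S diag(d)`, the
  columns `V_β` of `S` satisfy `A V_β + V_β Bᵀ = d_β V_β`; for an eigenvector `y` of `Bᵀ`
  (`Bᵀ y = ρ y`, which exists over an algebraically closed field) the vectors `V_β y` are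
  eigenvectors of `A` (or zero), and they span `K^n` because the `V_β` span all matrices. For `B`
  one conjugates by the coordinate swap, which exchanges the two summands.

These are the linear-algebra inputs of the torus-straightening step in route
MatrixMultiplication/ToricBorderRank (item `HilbertMumfordHalf`): the Lie stabiliser of the
matrix multiplication tensor consists of Kronecker sums, and a semisimple element of it has
semisimple parts.

## References

Folklore (e.g. R. A. Horn, C. R. Johnson, *Topics in Matrix Analysis*, §4.4: the eigenvalues of
the Kronecker sum are the sums `λ_i(A) + λ_j(B)`; the converse direction used here is the
standard restriction argument).
-/

open Matrix
open scoped Kronecker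

namespace Literature.LinearAlgebra.Matrix

variable {K : Type*} [Field K] {n : Type*} [Fintype n] [DecidableEq n]

/-- **A matrix whose eigenvectors span is diagonalisable**: if every `w i` is an eigenvector of `A`
(or zero), `A (w i) = μ i • w i`, and the `w i` span `K^n`, then `A S = S diag(d)` for an invertible
`S` (whose columns are a basis extracted from the `w i`). [folklore] -/
theorem exists_mul_eq_mul_diagonal_of_span_eigenvectors (A : Matrix n n K) {ι : Type*}
    (w : ι → n → K) (μ : ι → K) (hw : ∀ i, A *ᵥ w i = μ i • w i)
    (hspan : Submodule.span K (Set.range w) = ⊤) :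
    ∃ (S : Matrix n n K) (d : n → K), IsUnit S.det ∧ A * S = S * diagonal d := by
  classical
  obtain ⟨b, hbsub, hbspan, hbli⟩ := exists_linearIndependent K (Set.range w)
  have hbtop : ⊤ ≤ Submodule.span K (Set.range ((↑) : b → n → K)) := by
    rw [Subtype.range_coe, hbspan, hspan]
  let B : Module.Basis b K (n → K) := Module.Basis.mk hbli hbtop
  haveI : Fintype b := (FiniteDimensional.fintypeBasisIndex B)
  have hcard : Fintype.card b = Fintype.card n := by
    rw [← Module.finrank_eq_card_basis B, Module.finrank_fintype_fun_eq_card]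
  let e : b ≃ n := Fintype.equivOfCardEq hcard
  let B' : Module.Basis n K (n → K) := B.reindex e
  -- every basis vector is one of the `w i`
  have hB'mem : ∀ j, ∃ i, w i = B' j := by
    intro j
    have h1 : B' j = ((e.symm j : b) : n → K) := by
      simp [B', B, Module.Basis.reindex_apply, Module.Basis.mk_apply]
    have h2 : ((e.symm j : b) : n → K) ∈ Set.range w := hbsub (e.symm j).2
    obtain ⟨i, hi⟩ := h2
    exact ⟨i, hi.trans h1.symm⟩
  choose idx hidx using hB'mem
  refine ⟨Matrix.of fun a j => B' j a, fun j => μ (idx j), ?_, ?_⟩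
  · -- the columns form a basis, so the matrix is invertible
    have hli : LinearIndependent K (Matrix.of fun a j => B' j a).col := by
      have : (Matrix.of fun a j => B' j a).col = fun j => B' j := by
        funext j a
        rfl
      rw [this]
      exact B'.linearIndependent
    have hU : IsUnit (Matrix.of fun a j => B' j a) := linearIndependent_cols_iff_isUnit.mp hli
    exact (Matrix.isUnit_iff_isUnit_det _).mp hU
  · ext a j
    rw [mul_diagonal, Matrix.mul_apply]
    have h := congr_fun (hw (idx j)) a
    rw [hidx j, mulVec, dotProduct] at h
    simp only [Pi.smul_apply, smul_eq_mul] at h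
    simp only [Matrix.of_apply]
    rw [h, mul_comm]

/-- The Kronecker sum `A ⊗ 1 + 1 ⊗ B` acts on `v ∈ K^{n × n}`, read as the matrix
`V = (v(i,m))_{i,m}`, by `V ↦ A V + V Bᵀ`. [folklore] -/
theorem kroneckerSum_mulVec_apply (A B : Matrix n n K) (v : n × n → K) (i m : n) :
    ((A ⊗ₖ (1 : Matrix n n K) + (1 : Matrix n n K) ⊗ₖ B) *ᵥ v) (i, m) =
      (A * Matrix.of (fun i m => v (i, m)) + Matrix.of (fun i m => v (i, m)) * Bᵀ) i m := by
  rw [add_mulVec, Pi.add_apply, Matrix.add_apply]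
  congr 1
  · rw [mulVec, dotProduct, Fintype.sum_prod_type, Matrix.mul_apply]
    refine Finset.sum_congr rfl fun k _ => ?_
    simp only [kronecker_apply, Matrix.one_apply, mul_ite, mul_one, mul_zero, ite_mul, zero_mul,
      Matrix.of_apply]
    rw [Finset.sum_ite_eq Finset.univ m]
    simp
  · rw [mulVec, dotProduct, Fintype.sum_prod_type, Matrix.mul_apply]
    rw [Finset.sum_eq_single i]
    · refine Finset.sum_congr rfl fun l _ => ?_
      simp only [kronecker_apply, Matrix.one_apply_eq, one_mul, Matrix.of_apply,
        Matrix.transpose_apply]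
      ring
    · intro k _ hk
      refine Finset.sum_eq_zero fun l _ => ?_
      simp [Matrix.one_apply_ne (Ne.symm hk)]
    · intro h
      exact absurd (Finset.mem_univ i) h

/-- Columns of a diagonalising matrix of `A ⊗ 1 + 1 ⊗ B`, read as matrices, are "eigenmatrices":
if `(A ⊗ 1 + 1 ⊗ B) S = S diag(d)` then `A V_β + V_β Bᵀ = d_β V_β` for the `β`-th column `V_β` of
`S`. [folklore] -/
theorem kroneckerSum_col_eq (A B : Matrix n n K) (S : Matrix (n × n) (n × n) K) (d : n × n → K)
    (h : (A ⊗ₖ (1 : Matrix n n K) + (1 : Matrix n n K) ⊗ₖ B) * S = S * diagonal d) (β : n × n) :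
    A * Matrix.of (fun i m => S (i, m) β) + Matrix.of (fun i m => S (i, m) β) * Bᵀ =
      d β • Matrix.of (fun i m => S (i, m) β) := by
  ext i m
  have hcol := congr_fun (congr_fun h (i, m)) β
  rw [mul_diagonal, Matrix.mul_apply] at hcol
  have hmv := kroneckerSum_mulVec_apply A B (fun a => S a β) i m
  rw [mulVec, dotProduct] at hmv
  simp only [Matrix.smul_apply, smul_eq_mul, Matrix.of_apply]
  rw [← hmv, hcol, mul_comm]

/-- Every matrix is a combination of the columns (read as matrices) of an invertible
`S ∈ GL(K^{n×n})`: for any `Z` there are coefficients `c` with `Z = Σ_β c_β V_β`. [folklore] -/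
theorem exists_eq_sum_smul_col (S : Matrix (n × n) (n × n) K) (hS : IsUnit S.det)
    (Z : Matrix n n K) :
    ∃ c : n × n → K, Z = ∑ β, c β • Matrix.of (fun i m => S (i, m) β) := by
  have hsurj : Function.Surjective S.mulVec :=
    Matrix.mulVec_surjective_iff_isUnit.mpr ((Matrix.isUnit_iff_isUnit_det S).mpr hS)
  obtain ⟨c, hc⟩ := hsurj fun im => Z im.1 im.2
  refine ⟨c, ?_⟩
  ext i m
  have := congr_fun hc (i, m)
  rw [mulVec, dotProduct] at this
  rw [← this, Matrix.sum_apply]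
  refine Finset.sum_congr rfl fun β _ => ?_
  simp [Matrix.smul_apply, mul_comm]

/-- **Left summand of a diagonalisable Kronecker sum is diagonalisable.** If
`(A ⊗ 1 + 1 ⊗ B) S = S diag(d)` with `S` invertible (and `n` nonempty), then `A P = P diag(e)` for
some invertible `P`: for an eigenvector `y` of `Bᵀ` the vectors `V_β y` (`V_β` the columns of `S`
read as matrices) are eigenvectors of `A` spanning `K^n`. [folklore] -/
theorem exists_mul_eq_mul_diagonal_left_of_kroneckerSum [IsAlgClosed K] [Nonempty n]
    (A B : Matrix n n K) (S : Matrix (n × n) (n × n) K) (d : n × n → K) (hS : IsUnit S.det)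
    (h : (A ⊗ₖ (1 : Matrix n n K) + (1 : Matrix n n K) ⊗ₖ B) * S = S * diagonal d) :
    ∃ (P : Matrix n n K) (e : n → K), IsUnit P.det ∧ A * P = P * diagonal e := by
  classical
  -- an eigenvector `y` of `Bᵀ`
  obtain ⟨ρ, hρ⟩ := Module.End.exists_eigenvalue (Matrix.toLin' Bᵀ)
  obtain ⟨y, hy⟩ := hρ.exists_hasEigenvector
  have hyeq : Bᵀ *ᵥ y = ρ • y := by
    have := hy.apply_eq_smul
    rwa [Matrix.toLin'_apply] at this
  have hy0 : y ≠ 0 := hy.2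
  -- the eigenvectors `V_β y` of `A`
  set V : n × n → Matrix n n K := fun β => Matrix.of (fun i m => S (i, m) β) with hV
  have hw : ∀ β, A *ᵥ (V β *ᵥ y) = (d β - ρ) • (V β *ᵥ y) := by
    intro β
    have hc := kroneckerSum_col_eq A B S d h β
    have h1 : (A * V β + V β * Bᵀ) *ᵥ y = (d β • V β) *ᵥ y := by rw [← hc]
    rw [add_mulVec, ← mulVec_mulVec, ← mulVec_mulVec, hyeq, mulVec_smul, smul_mulVec]
      at h1
    rw [sub_smul]
    exact eq_sub_of_add_eq h1
  -- they span
  have hspan : Submodule.span K (Set.range fun β => V β *ᵥ y) = ⊤ := by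
    rw [eq_top_iff]
    intro u _
    obtain ⟨j₀, hj₀⟩ : ∃ j₀, y j₀ ≠ 0 := by
      by_contra hcon
      push Not at hcon
      exact hy0 (funext hcon)
    set Z : Matrix n n K := Matrix.of fun i j => if j = j₀ then u i * (y j₀)⁻¹ else 0 with hZ
    have hZy : Z *ᵥ y = u := by
      funext i
      rw [mulVec, dotProduct, Finset.sum_eq_single j₀]
      · simp only [hZ, Matrix.of_apply, if_true]
        rw [mul_assoc, inv_mul_cancel₀ hj₀, mul_one]
      · intro j _ hj
        simp [hZ, hj]
      · intro hh; exact absurd (Finset.mem_univ j₀) hh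
    obtain ⟨c, hc⟩ := exists_eq_sum_smul_col S hS Z
    rw [← hZy, hc, Matrix.sum_mulVec]
    refine Submodule.sum_mem _ fun β _ => ?_
    rw [smul_mulVec]
    exact Submodule.smul_mem _ _ (Submodule.subset_span ⟨β, rfl⟩)
  exact exists_mul_eq_mul_diagonal_of_span_eigenvectors A (fun β => V β *ᵥ y) (fun β => d β - ρ)
    hw hspan

omit [Fintype n] in
/-- The coordinate swap exchanges the two summands of a Kronecker sum:
`(A ⊗ 1 + 1 ⊗ B)` reindexed by `Prod.swap` is `B ⊗ 1 + 1 ⊗ A`. [folklore] -/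
theorem kroneckerSum_submatrix_swap (A B : Matrix n n K) :
    (A ⊗ₖ (1 : Matrix n n K) + (1 : Matrix n n K) ⊗ₖ B).submatrix Prod.swap Prod.swap =
      B ⊗ₖ (1 : Matrix n n K) + (1 : Matrix n n K) ⊗ₖ A := by
  ext ⟨m, i⟩ ⟨l, k⟩
  simp only [submatrix_apply, Prod.swap_prod_mk, Matrix.add_apply, kronecker_apply]
  ring

/-- **Right summand of a diagonalisable Kronecker sum is diagonalisable** (from the left case by
the coordinate swap). [folklore] -/
theorem exists_mul_eq_mul_diagonal_right_of_kroneckerSum [IsAlgClosed K] [Nonempty n]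
    (A B : Matrix n n K) (S : Matrix (n × n) (n × n) K) (d : n × n → K) (hS : IsUnit S.det)
    (h : (A ⊗ₖ (1 : Matrix n n K) + (1 : Matrix n n K) ⊗ₖ B) * S = S * diagonal d) :
    ∃ (Q : Matrix n n K) (e : n → K), IsUnit Q.det ∧ B * Q = Q * diagonal e := by
  classical
  let σ : n × n ≃ n × n := Equiv.prodComm n n
  have hσ : (σ : n × n → n × n) = Prod.swap := rfl
  have h' : (B ⊗ₖ (1 : Matrix n n K) + (1 : Matrix n n K) ⊗ₖ A) * S.submatrix σ σ =
      S.submatrix σ σ * diagonal (d ∘ σ) := by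
    rw [← kroneckerSum_submatrix_swap A B, ← hσ, submatrix_mul_equiv, h, ← submatrix_diagonal_equiv,
      submatrix_mul_equiv]
  have hS' : IsUnit (S.submatrix σ σ).det := by
    rwa [det_submatrix_equiv_self]
  exact exists_mul_eq_mul_diagonal_left_of_kroneckerSum B A (S.submatrix σ σ) (d ∘ σ) hS' h'

end Literature.LinearAlgebra.Matrix
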